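import Summits.HodgeConjecture.HodgeConjecture.Theorems.BoundaryReadoutPullbackAlgebraicZbarBookkeeping
import Literature.AlgebraicGeometry.Resolution.ExceptionalHostSmooth
import Mathlib.AlgebraicGeometry.Geometrically.Irreducible
import HarnessLib

/-!
# Crux `PullbackAlgebraic` (stmt-HodgeConjecture-1071): the exceptional divisor is a smooth projective
# variety (hypothesis `hE`), from its Zariski-local triviality

Work item stmt-HodgeConjecture-1071. Discharge of the hypothesis `hE` of
`PullbackAlgebraic_of_exceptionalDivisor₂` (`Theorems/BoundaryReadoutPullbackAlgebraicZbarBookkeeping`),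
granted the named fact `Hartshorne1977_exceptionalDivisor_locallyTrivial`: for the blowing up
`β : B → V` of a smooth projective `V` (dimension `m + r + 1`) along a closed immersion `i : Z ↪ V` from a
smooth projective `Z` (dimension `m`), the exceptional divisor `E = B ×_V Z` with `q = pr₂ : E → Z` is a
smooth projective variety of dimension `m + r`:

* `q` is smooth of relative dimension `r` (Zariski-locally on the source it is an isomorphism
  followed by `U × ℙʳ → U ↪ Z`), so `E → Spec ℂ` is smooth of relative dimension `m + r`;
* `E ↪ B` is a closed immersion and `B` is projective (a blowing up of a projective variety along a
  regular centre, `IsBlowup.isSmoothProjective`), so `E` is projective;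
* `E` is irreducible: it is the union of the opens `q⁻¹U_z ≅ U_z × ℙʳ`, each irreducible, any two of
  which meet (`Z` is irreducible and `q` is onto) — `isPreirreducible_iUnion_of_forall_inter_nonempty`;
  being smooth it is reduced, hence integral, hence geometrically irreducible over `ℂ`.

* `ker_ne_bot_of_dim_lt` — a closed immersion between smooth projective varieties of different
  dimensions has non-zero kernel;
* `isSmoothProjective_exceptionalDivisor` — the statement of `hE`;
* `PullbackAlgebraic_of_exceptionalDivisor₃` / `boundaryReadout_pullbackAlgebraic_of_exceptionalDivisor₃`
  — **the crux from the named fact and the section pull-back only**.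

## References

* [Hartshorne1977] R. Hartshorne, Algebraic Geometry (1977), II Thm. 8.24, III Prop. 10.1.
* [Fulton1998] W. Fulton, Intersection Theory, 2nd ed. (1998), §5.1, App. B.6.
-/

noncomputable section

-- every declaration of this problem lives in `Summit.HodgeConjecture.HodgeConjecture.…` (summit = sub-problem)
set_option linter.dupNamespace false

namespace Summit.HodgeConjecture.HodgeConjecture.Theorems

open CategoryTheory CategoryTheory.Limits AlgebraicGeometry MonoidalCategory CartesianMonoidalCategory
open TopologicalSpace
open Literature.AlgebraicGeometry Literature.AlgebraicGeometry.Motives Literature.AlgebraicGeometry.Resolution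
open Literature.AlgebraicGeometry.HodgeTheory

/-- The kernel of a closed immersion between smooth projective varieties of different dimensions is
non-zero (otherwise it is an isomorphism, hence a homeomorphism, and the dimensions agree). [folklore] -/
theorem ker_ne_bot_of_dim_lt {m N : ℕ} {V Z : SchemeOver ℂ} (hV : IsSmoothProjective N V)
    (hZ : IsSmoothProjective m Z) (hmN : m < N) (i : Z ⟶ V) [IsClosedImmersion i.left] :
    i.left.ker ≠ ⊥ := by
  intro h
  haveI : IsIso i.left := IsClosedImmersion.isIso_iff_ker_eq_bot.2 h
  haveI := hV.smoothOfRelativeDimension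
  haveI := hZ.smoothOfRelativeDimension
  haveI : IsIntegral Z.left := IsSmoothProjective.isIntegral_holds hZ
  haveI : Nonempty ↥V.left := ⟨i.left (Classical.arbitrary _)⟩
  have hZd := topologicalKrullDim_eq_of_smoothOfRelativeDimension (f := Z.hom) (n := m)
  have hVd := topologicalKrullDim_eq_of_smoothOfRelativeDimension (f := V.hom) (n := N)
  have heq := IsHomeomorph.topologicalKrullDim_eq _ i.left.homeomorph.isHomeomorph
  have h1 : ((m : ℕ∞) : WithBot ℕ∞) = ((N : ℕ∞) : WithBot ℕ∞) := by
    rw [WithBot.coe_natCast, WithBot.coe_natCast, ← hZd, ← hVd]; exact heq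
  have h2 : m = N := ENat.coe_inj.mp (WithBot.coe_inj.mp h1)
  omega

/-- **The exceptional divisor of the blowing up of a smooth projective variety along a smooth closed
subvariety is a smooth projective variety of dimension one less**, granted its Zariski-local
triviality over the centre (Hartshorne II 8.24 (b)): `E = B ×_V Z → Z` is smooth of relative dimension
`r` (locally `U × ℙʳ → U`), `E ↪ B` is a closed immersion into a projective variety, and `E` is
irreducible (a union of pairwise meeting irreducible opens `q⁻¹U ≅ U × ℙʳ`), reduced, hence
geometrically integral. [cite: Hartshorne1977, II Thm. 8.24] [cite: Fulton1998, App. B.6] -/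
theorem isSmoothProjective_exceptionalDivisor (hα : Hartshorne1977_exceptionalDivisor_locallyTrivial.{0}) :
    ∀ ⦃m r : ℕ⦄ ⦃V Z B : SchemeOver ℂ⦄ (i : Z ⟶ V) (β : B ⟶ V),
      IsSmoothProjective (m + r + 1) V → IsSmoothProjective m Z → IsClosedImmersion i.left →
      IsBlowup β.left i.left.ker →
      IsSmoothProjective (m + r) (Over.mk (pullback.snd β.left i.left ≫ Z.hom) : SchemeOver ℂ) := by
  intro m r V Z B i β hV hZ hi hβ
  haveI := hi
  haveI := hZ.smoothOfRelativeDimension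
  haveI : IsIntegral Z.left := IsSmoothProjective.isIntegral_holds hZ
  have hP : IsSmoothProjective r (projectiveSpace r ℂ) := isSmoothProjective_projectiveSpace' r
  haveI := hP.smoothOfRelativeDimension
  haveI := hP.geometricallyIrreducible
  haveI : Smooth (projectiveSpace r ℂ).hom :=
    SmoothOfRelativeDimension.smooth (n := r) (f := (projectiveSpace r ℂ).hom)
  -- the trivialising cover of the centre
  have htriv := hα ℂ i β hV hZ hi hβ
  choose U hzU ψ hψ using htriv
  -- the open cover of `E` by the `q⁻¹ U_z`
  let O : Z.left → (pullback β.left i.left).Opens := fun z ↦ pullback.snd β.left i.left ⁻¹ᵁ U z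
  have hO : iSup O = ⊤ := top_le_iff.mp fun e _ ↦
    Opens.mem_iSup.mpr ⟨pullback.snd β.left i.left e, hzU (pullback.snd β.left i.left e)⟩
  -- over each `U z`, `q` is an isomorphism followed by `U × ℙʳ → U ↪ Z`
  have hpiece : ∀ z, SmoothOfRelativeDimension r ((O z).ι ≫ pullback.snd β.left i.left) := by
    intro z
    let UO : SchemeOver ℂ := Over.mk ((U z).ι ≫ Z.hom)
    let g₁ : (↑(pullback.snd β.left i.left ⁻¹ᵁ U z) : Scheme) ⟶ (UO ⊗ projectiveSpace r ℂ).left :=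
      (ψ z).hom.left
    let f₁ : (UO ⊗ projectiveSpace r ℂ).left ⟶ (↑(U z) : Scheme) :=
      (fst UO (projectiveSpace r ℂ)).left
    have e1 : (O z).ι ≫ pullback.snd β.left i.left = g₁ ≫ f₁ ≫ (U z).ι := (hψ z).symm
    haveI : IsIso g₁ := inferInstanceAs (IsIso (ψ z).hom.left)
    haveI : SmoothOfRelativeDimension r f₁ := by
      have := smoothOfRelativeDimension_isStableUnderBaseChange (n := r)
      change SmoothOfRelativeDimension r (pullback.fst ((U z).ι ≫ Z.hom) (projectiveSpace r ℂ).hom)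
      exact MorphismProperty.pullback_fst (P := @SmoothOfRelativeDimension r) _ _
        hP.smoothOfRelativeDimension
    rw [e1]
    have h3 : SmoothOfRelativeDimension (0 + (r + 0)) (g₁ ≫ f₁ ≫ (U z).ι) := inferInstance
    rwa [Nat.zero_add, Nat.add_zero] at h3
  haveI hqs : SmoothOfRelativeDimension r (pullback.snd β.left i.left) :=
    IsZariskiLocalAtSource.of_iSup_eq_top O hO hpiece
  -- smoothness of `E → Spec ℂ`
  have hsm : SmoothOfRelativeDimension (m + r) (pullback.snd β.left i.left ≫ Z.hom) := by
    have h : SmoothOfRelativeDimension (r + m) (pullback.snd β.left i.left ≫ Z.hom) := inferInstance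
    rwa [Nat.add_comm] at h
  -- projectivity: `E ↪ B`, `B` projective
  have hBO : IsSmoothProjective (m + r + 1) (Over.mk (β.left ≫ V.hom) : SchemeOver ℂ) :=
    hβ.isSmoothProjective hV (ker_ne_bot_of_dim_lt hV hZ (by omega) i)
      (isRegular_ker_subscheme i.left (isRegular_of_isSmoothProjective hZ))
  obtain ⟨N, ι, hι⟩ := hBO.isProjectiveOver
  let jE : (Over.mk (pullback.snd β.left i.left ≫ Z.hom) : SchemeOver ℂ) ⟶
      (Over.mk (β.left ≫ V.hom) : SchemeOver ℂ) :=
    Over.homMk (pullback.fst β.left i.left) (by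
      change pullback.fst β.left i.left ≫ β.left ≫ V.hom = pullback.snd β.left i.left ≫ Z.hom
      rw [pullback.condition_assoc, Over.w i])
  have hproj : IsProjectiveOver (Over.mk (pullback.snd β.left i.left ≫ Z.hom) : SchemeOver ℂ) := by
    refine ⟨N, jE ≫ ι, ?_⟩
    rw [Over.comp_left]
    haveI : IsClosedImmersion jE.left :=
      inferInstanceAs (IsClosedImmersion (pullback.fst β.left i.left))
    infer_instance
  -- `q` is onto (locally it is `U × ℙʳ → U`)
  have hsurj : ∀ z, ∀ u ∈ U z, ∃ e : ↥(pullback β.left i.left), pullback.snd β.left i.left e = u := by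
    intro z u hu
    haveI : Surjective (fst (Over.mk ((U z).ι ≫ Z.hom) : SchemeOver ℂ) (projectiveSpace r ℂ)).left := by
      change Surjective (pullback.fst ((U z).ι ≫ Z.hom) (projectiveSpace r ℂ).hom)
      infer_instance
    obtain ⟨y, hy⟩ :=
      (fst (Over.mk ((U z).ι ≫ Z.hom) : SchemeOver ℂ) (projectiveSpace r ℂ)).left.surjective ⟨u, hu⟩
    refine ⟨(O z).ι ((ψ z).inv.left y), ?_⟩
    have h := congrArg (fun φ ↦ φ ((ψ z).inv.left y)) (hψ z)
    simp only [Scheme.Hom.comp_apply] at h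
    have hinv : (ψ z).hom.left ((ψ z).inv.left y) = y := by
      rw [← Scheme.Hom.comp_apply, Over.inv_left_hom_left]
      rfl
    rw [hinv, hy] at h
    exact h.symm
  -- irreducibility: the pieces `q⁻¹ U_z ≅ U_z × ℙʳ` are irreducible and pairwise meet
  have hOirr : ∀ z, IsPreirreducible ((O z : (pullback β.left i.left).Opens) :
      Set ↥(pullback β.left i.left)) := by
    intro z
    let UO : SchemeOver ℂ := Over.mk ((U z).ι ≫ Z.hom)
    haveI : Nonempty (↑(U z) : Scheme) := ⟨(⟨z, hzU z⟩ : U z)⟩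
    have hUint : IsIntegral (↑(U z) : Scheme) := isIntegral_of_isOpenImmersion (U z).ι
    have hprod : IrreducibleSpace ↥((UO ⊗ projectiveSpace r ℂ).left) := by
      haveI : IsIntegral UO.left := hUint
      change IrreducibleSpace ↥(pullback UO.hom (projectiveSpace r ℂ).hom)
      infer_instance
    -- `O z` is the image of the irreducible `U_z × ℙʳ` under `ψ⁻¹ ≫ ι`
    have hOeq : ((O z : (pullback β.left i.left).Opens) : Set ↥(pullback β.left i.left)) =
        ((ψ z).inv.left ≫ (O z).ι) '' Set.univ := by
      apply subset_antisymm
      · intro e he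
        refine ⟨(ψ z).hom.left ⟨e, he⟩, Set.mem_univ _, ?_⟩
        have hx : (ψ z).inv.left ((ψ z).hom.left ⟨e, he⟩) = ⟨e, he⟩ := by
          rw [← Scheme.Hom.comp_apply (ψ z).hom.left (ψ z).inv.left, Over.hom_left_inv_left]
          rfl
        exact (congrArg (fun w ↦ (O z).ι w) hx).trans rfl
      · rintro _ ⟨y, -, rfl⟩
        exact (Scheme.Opens.range_ι (O z)).subset ⟨(ψ z).inv.left y, rfl⟩
    rw [hOeq]
    exact ((IrreducibleSpace.isIrreducible_univ _).image _
      ((ψ z).inv.left ≫ (O z).ι).continuous.continuousOn).isPreirreducible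
  have hirr : IrreducibleSpace ↥(pullback β.left i.left) := by
    have hOo : ∀ z, IsOpen ((O z : (pullback β.left i.left).Opens) : Set ↥(pullback β.left i.left)) :=
      fun z ↦ (O z).2
    have hall : IsPreirreducible (⋃ z, ((O z : (pullback β.left i.left).Opens) :
        Set ↥(pullback β.left i.left))) := by
      refine isPreirreducible_iUnion_of_forall_inter_nonempty hOo hOirr fun z z' _ _ ↦ ?_
      obtain ⟨u, hu, hu'⟩ :=
        nonempty_preirreducible_inter (U z).2 (U z').2 ⟨z, hzU z⟩ ⟨z', hzU z'⟩
      obtain ⟨e, he⟩ := hsurj z u hu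
      refine ⟨e, ?_, ?_⟩
      · change pullback.snd β.left i.left e ∈ U z
        rw [he]; exact hu
      · change pullback.snd β.left i.left e ∈ U z'
        rw [he]; exact hu'
    have hcov : (⋃ z, ((O z : (pullback β.left i.left).Opens) : Set ↥(pullback β.left i.left))) =
        Set.univ :=
      Set.eq_univ_of_forall fun e ↦ Set.mem_iUnion.mpr ⟨pullback.snd β.left i.left e, hzU _⟩
    rw [hcov] at hall
    obtain ⟨e, -⟩ := hsurj (Classical.arbitrary Z.left) _ (hzU (Classical.arbitrary Z.left))
    exact @IrreducibleSpace.mk _ _ ⟨hall⟩ ⟨e⟩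
  -- geometrically irreducible: integral over an algebraically closed field
  haveI : Smooth (pullback.snd β.left i.left ≫ Z.hom) :=
    SmoothOfRelativeDimension.smooth (n := m + r) (f := pullback.snd β.left i.left ≫ Z.hom)
  haveI : IsReduced (pullback β.left i.left) :=
    isReduced_of_smooth_over_field (pullback.snd β.left i.left ≫ Z.hom)
  haveI : IsIntegral (pullback β.left i.left) := isIntegral_of_irreducibleSpace_of_isReduced _
  haveI := geometricallyIntegral_of_isAlgClosed (pullback.snd β.left i.left ≫ Z.hom)
  have hgi : GeometricallyIrreducible (pullback.snd β.left i.left ≫ Z.hom) := inferInstance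
  exact ⟨hsm, hproj, hgi⟩

/-- **The crux `PullbackAlgebraic` from the named fact (Zariski-local triviality of the exceptional
divisor, Hartshorne II 8.24 (b)) and the section pull-back only.**
[cite: Fulton1998, §5.1, §6.2 and Cor. 19.2 (b)] [cite: Hartshorne1977, II Thm. 8.24] -/
theorem PullbackAlgebraic_of_exceptionalDivisor₃
    (hα : Hartshorne1977_exceptionalDivisor_locallyTrivial.{0})
    (hSec : ∀ ⦃n r : ℕ⦄ ⦃X E : SchemeOver ℂ⦄ (q : E ⟶ X) (s : X ⟶ E), IsSmoothProjective n X →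
      IsSmoothProjective (n + r) E → s ≫ q = 𝟙 X →
      (∀ x : X.left, ∃ U : X.left.Opens, x ∈ U ∧
        ∃ ψ : (Over.mk ((q.left ⁻¹ᵁ U).ι ≫ E.hom) : SchemeOver ℂ) ≅
            (Over.mk (U.ι ≫ X.hom) : SchemeOver ℂ) ⊗ Motives.projectiveSpace r ℂ,
          ψ.hom.left ≫ (fst (Over.mk (U.ι ≫ X.hom) : SchemeOver ℂ)
            (Motives.projectiveSpace r ℂ)).left ≫ U.ι = (q.left ⁻¹ᵁ U).ι ≫ q.left) →
      ∀ (p : ℕ), ∀ y ∈ algebraicClasses E p,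
        complexBetti.map s (2 * p) y ∈ algebraicClasses X p) :
    Summit.HodgeConjecture.HodgeConjecture.Theses.QbarEnvelope.PullbackAlgebraic :=
  PullbackAlgebraic_of_exceptionalDivisor₂ hα (isSmoothProjective_exceptionalDivisor hα) hSec

/-- The same for the `BoundaryReadout` decl of the crux. [cite: Fulton1998, §19.2 Cor. 19.2 (b)] -/
theorem boundaryReadout_pullbackAlgebraic_of_exceptionalDivisor₃
    (hα : Hartshorne1977_exceptionalDivisor_locallyTrivial.{0})
    (hSec : ∀ ⦃n r : ℕ⦄ ⦃X E : SchemeOver ℂ⦄ (q : E ⟶ X) (s : X ⟶ E), IsSmoothProjective n X →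
      IsSmoothProjective (n + r) E → s ≫ q = 𝟙 X →
      (∀ x : X.left, ∃ U : X.left.Opens, x ∈ U ∧
        ∃ ψ : (Over.mk ((q.left ⁻¹ᵁ U).ι ≫ E.hom) : SchemeOver ℂ) ≅
            (Over.mk (U.ι ≫ X.hom) : SchemeOver ℂ) ⊗ Motives.projectiveSpace r ℂ,
          ψ.hom.left ≫ (fst (Over.mk (U.ι ≫ X.hom) : SchemeOver ℂ)
            (Motives.projectiveSpace r ℂ)).left ≫ U.ι = (q.left ⁻¹ᵁ U).ι ≫ q.left) →
      ∀ (p : ℕ), ∀ y ∈ algebraicClasses E p,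
        complexBetti.map s (2 * p) y ∈ algebraicClasses X p) :
    Summit.HodgeConjecture.HodgeConjecture.Theses.BoundaryReadout.PullbackAlgebraic :=
  fun _ _ hX _ _ hW ι p c' hc' ↦ PullbackAlgebraic_of_exceptionalDivisor₃ hα hSec hX hW ι p c' hc'

end Summit.HodgeConjecture.HodgeConjecture.Theorems

end
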